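import Summits.Langlands.Langlands.Statement
import Summits.Langlands.Langlands.Theorems.IrreducibilityBySelfDualityReciprocityUpToIrreducibilityCorrespondsConj
import HarnessLib

/-!
# Seams of piece `X₁ = AutToGalCM` of crux `ReciprocityTRCM` (item stmt-Langlands-1093, line `pieces`)

Support file (closes nothing; `--supports stmt-Langlands-1093`).  Stub `stub_autToGalCM` of the line
(VERBATIM item stmt-Langlands-1059) reads
`∀ F CM, ∃ R : ReciprocityData F, ∀ n > 0, ∀ hcpt, AutomorphicToGalois n R hcpt`.
Two of its clauses are THEOREMS of the tree and are discharged here once and for all, so that every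
future sector proof of direction (A) only has to produce, for each `π, ℓ, ι`, SOME irreducible
pinned-geometric corresponding `ρ`:

* `automorphicToGalois_iff_forall_exists` (closed form: the registered helper stub
  `stub_automorphicToGalois_iff_forall_exists`) — the uniqueness-up-to-conjugacy clause of
  `AutomorphicToGalois n R hcpt` is automatic (two avatars of one cuspidal `π`, one of them irreducible,
  are conjugate: Chebotarev + Brauer–Nesbitt, landed as
  `ReciprocityUpToIrreducibility.isConjugate_of_satakeFrobCompatibleAt`), for EVERY number field and
  every reciprocity datum;
* `nonempty_reciprocityData_iff` — after the statement re-type of 2026-08-16/17 (pins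
  `llc_isCanonical`, `llc_eps_isCanonical`), `Nonempty (ReciprocityData K)` is EXACTLY the existence, at
  every finite place `v`, of a local Langlands datum for `GL_n(K_v)` whose local Artin map and whose
  `ε`-system's Artin maps at every finite `E/K_v` are the canonical ones (the text of item
  stmt-Langlands-17930 `CanonicalReciprocityData`, place by place) — the formal residue of the `∃ R` of
  the stub, which no file of the tree witnesses today;
* `autToGalCM_iff_exists`, `autToGalCM_of_nonempty_of_forall`, `nonempty_of_autToGalCM` — the stub's
  statement is equivalent to its uniqueness-free form, follows from non-vacuity over CM fields plus the
  `∀ R` form of (A)-existence (the shape of the re-typed summit), and implies non-vacuity over CM fields.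

No definitions, no named facts; std axioms.  Imports the summit `Statement` and the landed conjugacy
file only (not the route module `Theses.BaseFieldAscent`, none of whose declarations is used).

## References

* P. Deligne, J.-P. Serre, *Formes modulaires de poids 1*, ASENS 7 (1974), Lemme 3.2.
  [DeligneSerreASENS1974]
* K. Buzzard, T. Gee, *The conjectural connections between automorphic representations and Galois
  representations*, LMS Lecture Notes 414 (2014), Conj. 3.2.1–3.2.2. [BuzzardGeeLMS2014]
* M. Harris, R. Taylor, *The geometry and cohomology of some simple Shimura varieties*, Ann. of Math.
  Stud. 151 (2001), Thm. A. [HarrisTaylorAMS2001]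
-/

noncomputable section

set_option linter.dupNamespace false -- project-wide option (lakefile weak.linter.dupNamespace); `Summit.Langlands.Langlands` is the mandated namespace

open scoped MatrixGroups NumberField
open NumberField IsDedekindDomain Filter
open Literature.NumberTheory.Automorphic Literature.NumberTheory.GaloisRepresentations
open Summit.Langlands

namespace Summit.Langlands.Langlands.Theorems.ReciprocityTRCM

/-! ## 1. The uniqueness clause of (A) is a theorem -/

section Uniqueness

variable {K : Type} [Field K] [NumberField K]

/-- **(A) ⇔ (A)-existence, for the same reciprocity datum.**  `AutomorphicToGalois n R hcpt` holds iff
every L-algebraic cuspidal `π` has, for all `ℓ, ι`, SOME irreducible pinned-geometric `ρ` corresponding to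
it: the uniqueness-up-to-conjugacy clause follows from Chebotarev + Brauer–Nesbitt (two avatars of one
`π`, one irreducible, are conjugate — `isConjugate_of_satakeFrobCompatibleAt`, which only uses the
Satake–Frobenius half of `Corresponds`).  Any number field, any `n`, any `R`.
[cite: DeligneSerreASENS1974, Lemme 3.2] -/
theorem automorphicToGalois_iff_forall_exists {n : ℕ} (R : ReciprocityData K)
    (hcpt : isCompact_glFiniteIntegralLevel n K) :
    AutomorphicToGalois n R hcpt ↔
      ∀ π : CuspidalAutomorphicRepData n K hcpt, π.1.IsLAlgebraic →
        ∀ (ℓ : ℕ) [Fact ℓ.Prime] (ι : PadicAlgCl ℓ ≃+* ℂ),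
          ∃ ρ : FramedGaloisRep K (PadicAlgCl ℓ) n,
            ρ.toGaloisRep.IsIrreducible ∧ IsGeometricFramed R ρ ∧ Corresponds R ι π.1 ρ := by
  refine ⟨fun h π hL ℓ _ ι => ?_, fun h π hL ℓ _ ι => ?_⟩
  · obtain ⟨ρ, hirr, hgeo, hcorr, -⟩ := h π hL ℓ ι
    exact ⟨ρ, hirr, hgeo, hcorr⟩
  · obtain ⟨ρ, hirr, hgeo, hcorr⟩ := h π hL ℓ ι
    exact ⟨ρ, hirr, hgeo, hcorr, fun ρ' h' =>
      ReciprocityUpToIrreducibility.isConjugate_of_satakeFrobCompatibleAt π.1 ι hirr hcorr.1 h'.1⟩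

/-- **(A) from (A)-existence** (the direction every sector proof uses). [cite: DeligneSerreASENS1974, Lemme 3.2] -/
theorem automorphicToGalois_of_forall_exists {n : ℕ} (R : ReciprocityData K)
    (hcpt : isCompact_glFiniteIntegralLevel n K)
    (hE : ∀ π : CuspidalAutomorphicRepData n K hcpt, π.1.IsLAlgebraic →
      ∀ (ℓ : ℕ) [Fact ℓ.Prime] (ι : PadicAlgCl ℓ ≃+* ℂ),
        ∃ ρ : FramedGaloisRep K (PadicAlgCl ℓ) n,
          ρ.toGaloisRep.IsIrreducible ∧ IsGeometricFramed R ρ ∧ Corresponds R ι π.1 ρ) :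
    AutomorphicToGalois n R hcpt :=
  (automorphicToGalois_iff_forall_exists R hcpt).mpr hE

end Uniqueness

/-- **Registered helper stub of line `pieces` (crux stmt-Langlands-1093): (A) ⇔ (A)-existence, closed form**
of `automorphicToGalois_iff_forall_exists` — for every number field `K`, rank `n`, reciprocity datum `R` and
level-compactness witness `hcpt`, `AutomorphicToGalois n R hcpt` holds iff every L-algebraic cuspidal `π` has,
for all `ℓ, ι`, some irreducible pinned-geometric corresponding `ρ` (uniqueness up to conjugacy is free).
[cite: DeligneSerreASENS1974, Lemme 3.2] -/
theorem stub_automorphicToGalois_iff_forall_exists : ∀ (K : Type) [Field K] [NumberField K] (n : ℕ) (R : ReciprocityData K) (hcpt : Literature.NumberTheory.Automorphic.isCompact_glFiniteIntegralLevel n K), AutomorphicToGalois n R hcpt ↔ ∀ π : Literature.NumberTheory.Automorphic.CuspidalAutomorphicRepData n K hcpt, π.1.IsLAlgebraic → ∀ (ℓ : ℕ) [Fact ℓ.Prime] (ι : PadicAlgCl ℓ ≃+* ℂ), ∃ ρ : Literature.NumberTheory.GaloisRepresentations.FramedGaloisRep K (PadicAlgCl ℓ) n, ρ.toGaloisRep.IsIrreducible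 ∧ IsGeometricFramed R ρ ∧ Corresponds R ι π.1 ρ :=
  fun _K _ _ _n R hcpt => automorphicToGalois_iff_forall_exists R hcpt

/-! ## 2. Non-vacuity: what `∃ R : ReciprocityData K` asks, place by place -/

section NonVacuity

variable {K : Type} [Field K] [NumberField K]

/-- **Reciprocity data exist iff canonically normalised local Langlands data exist at every finite place**:
`Nonempty (ReciprocityData K)` is equivalent to: for every `v`, some `L : LocalLanglandsDatum (K_v)`
(Harris–Taylor's `rec`, with its Artin datum and `ε`-system) has THE canonical local Artin map
(`LocalArtinData.IsCanonical`) and an `ε`-system normalised against the canonical Artin map of every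
finite `E/K_v`.  (`→`: the structure fields; `←`: choice over `v`.)  This is the text of item
stmt-Langlands-17930 read place by place; the named fact `LocalLanglandsDatum.nonempty` does NOT supply
the two canonicity conjuncts. [cite: HarrisTaylorAMS2001, Thm. A] -/
theorem nonempty_reciprocityData_iff :
    Nonempty (ReciprocityData K) ↔
      ∀ v : HeightOneSpectrum (𝓞 K), ∃ L : LocalLanglandsDatum (v.adicCompletion K),
        L.artin.IsCanonical ∧
          ∀ (E : Type) [Field E] [ValuativeRel E] [TopologicalSpace E] [IsNonarchimedeanLocalField E]
            [Algebra (v.adicCompletion K) E] [FiniteDimensional (v.adicCompletion K) E],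
            (L.eps.artin E).IsCanonical := by
  constructor
  · rintro ⟨R⟩ v
    exact ⟨R.llc v, R.llc_isCanonical v, fun E _ _ _ _ _ _ => R.llc_eps_isCanonical v E⟩
  · intro h
    choose L hL hLE using h
    exact ⟨⟨L, hL, fun v E _ _ _ _ _ _ => hLE v E⟩⟩

end NonVacuity

/-! ## 3. The stub `stub_autToGalCM` (piece `X₁`): uniqueness-free form, `∀ R` form, non-vacuity -/

/-- **`X₁` ⇔ its uniqueness-free form**: direction (A) over CM fields for SOME reciprocity datum is
equivalent to (A)-existence (irreducible, pinned-geometric, corresponding at every finite place) for some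
datum — the conjugacy clause is `automorphicToGalois_iff_forall_exists`.
[cite: BuzzardGeeLMS2014, Conj. 3.2.1–3.2.2] [cite: DeligneSerreASENS1974, Lemme 3.2] -/
theorem autToGalCM_iff_exists :
    (∀ (F : Type) [Field F] [NumberField F], NumberField.IsCMField F → ∃ R : ReciprocityData F,
      ∀ n : ℕ, 0 < n → ∀ hcpt : isCompact_glFiniteIntegralLevel n F, AutomorphicToGalois n R hcpt) ↔
    (∀ (F : Type) [Field F] [NumberField F], NumberField.IsCMField F → ∃ R : ReciprocityData F,
      ∀ n : ℕ, 0 < n → ∀ (hcpt : isCompact_glFiniteIntegralLevel n F)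
        (π : CuspidalAutomorphicRepData n F hcpt), π.1.IsLAlgebraic →
          ∀ (ℓ : ℕ) [Fact ℓ.Prime] (ι : PadicAlgCl ℓ ≃+* ℂ),
            ∃ ρ : FramedGaloisRep F (PadicAlgCl ℓ) n,
              ρ.toGaloisRep.IsIrreducible ∧ IsGeometricFramed R ρ ∧ Corresponds R ι π.1 ρ) := by
  refine ⟨fun h F _ _ hF => ?_, fun h F _ _ hF => ?_⟩
  · obtain ⟨R, hR⟩ := h F hF
    exact ⟨R, fun n hn hcpt => (automorphicToGalois_iff_forall_exists R hcpt).mp (hR n hn hcpt)⟩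
  · obtain ⟨R, hR⟩ := h F hF
    exact ⟨R, fun n hn hcpt => automorphicToGalois_of_forall_exists R hcpt (hR n hn hcpt)⟩

/-- **`X₁` from non-vacuity over CM fields and the `∀ R` form of (A)-existence** (the shape of the
re-typed summit `∀ F, Nonempty (ReciprocityData F) ∧ ∀ 𝓡 …`, restricted to CM fields and to direction
(A)): pick any datum, apply (A)-existence to it, add uniqueness. [cite: BuzzardGeeLMS2014, Conj. 3.2.1–3.2.2] -/
theorem autToGalCM_of_nonempty_of_forall
    (hN : ∀ (F : Type) [Field F] [NumberField F], NumberField.IsCMField F →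
      Nonempty (ReciprocityData F))
    (hA : ∀ (F : Type) [Field F] [NumberField F], NumberField.IsCMField F → ∀ (R : ReciprocityData F)
      (n : ℕ), 0 < n → ∀ (hcpt : isCompact_glFiniteIntegralLevel n F)
        (π : CuspidalAutomorphicRepData n F hcpt), π.1.IsLAlgebraic →
          ∀ (ℓ : ℕ) [Fact ℓ.Prime] (ι : PadicAlgCl ℓ ≃+* ℂ),
            ∃ ρ : FramedGaloisRep F (PadicAlgCl ℓ) n,
              ρ.toGaloisRep.IsIrreducible ∧ IsGeometricFramed R ρ ∧ Corresponds R ι π.1 ρ) :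
    ∀ (F : Type) [Field F] [NumberField F], NumberField.IsCMField F → ∃ R : ReciprocityData F,
      ∀ n : ℕ, 0 < n → ∀ hcpt : isCompact_glFiniteIntegralLevel n F, AutomorphicToGalois n R hcpt := by
  intro F _ _ hF
  obtain ⟨R⟩ := hN F hF
  exact ⟨R, fun n hn hcpt => automorphicToGalois_of_forall_exists R hcpt (hA F hF R n hn hcpt)⟩

/-- **`X₁` implies non-vacuity over CM fields**: the stub is at least as strong as item stmt-Langlands-17930
(`∀ F, Nonempty (ReciprocityData F)`) restricted to CM fields — its first formal obligation, independent of
all automorphic content (see `nonempty_reciprocityData_iff` for what it asks place by place). [folklore] -/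
theorem nonempty_of_autToGalCM
    (h : ∀ (F : Type) [Field F] [NumberField F], NumberField.IsCMField F → ∃ R : ReciprocityData F,
      ∀ n : ℕ, 0 < n → ∀ hcpt : isCompact_glFiniteIntegralLevel n F, AutomorphicToGalois n R hcpt)
    (F : Type) [Field F] [NumberField F] (hF : NumberField.IsCMField F) :
    Nonempty (ReciprocityData F) := by
  obtain ⟨R, -⟩ := h F hF
  exact ⟨R⟩

end Summit.Langlands.Langlands.Theorems.ReciprocityTRCM

end
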